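import Literature.NumberTheory.Automorphic.ArchGroupGLCartan
import Literature.NumberTheory.Automorphic.HarishChandraGrowthGL
import Literature.NumberTheory.Automorphic.GLnAdelicStructureProofs
import HarnessLib

/-!
# The automorphy datum of `GL_n` over a number field is regular

Topic `NumberTheory/Automorphic`; companion of `AdelicGLnGlue` (the datum `AutomorphyDatum.gl n K hcpt`)
and `AutomorphicForms` (the hypothesis structure `AutomorphyDatum.IsRegular` consumed by Borel–Jacquet
1979, §4.3–4.6). Every one of the seven regularity conditions is a theorem of the tree for the honest
`GL_n` datum; this file assembles them:

* `𝔤 = 𝔤𝔩_n(K_∞)` is all of `M_n(K_∞)` (`archGroupGL_lie`), so it is trivially full;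
* `K_∞ ⊗ ℝ = ℝ^{r₁} × ℂ^{r₂}` is star-formally real (`isStarFormallyReal_mixedSpace`);
* the global Cartan decomposition `GL_n(K_∞) = K_∞ · exp 𝔭` (`hasCartanDecomposition_archGroupGL`,
  `ArchGroupGLCartan`);
* levels `{1} × U₀` (`U₀ ≤ GL_n(𝔸_K^∞)` compact open) are open in `G(𝔸_f) = range GLn.ofFinite`
  (the projection `GLn.sndHom` is continuous and a retraction of `GLn.ofFinite`), and every open
  subgroup of `G(𝔸_f)` contains one (intersect its preimage with the compact open `GL_n(𝒪̂_K)`,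
  `isOpen_glFiniteIntegralLevel` and the hypothesis `hcpt`);
* the height inequalities `1 ⊔ ‖g h‖ ≤ C_h (1 ⊔ ‖g‖)` (`one_sup_adelicHeightGL_mul_le`,
  `AdelicHeightGLProofs`), locally uniformly on `G_∞` (`exists_adelicHeightGL_ofInfinite_le_of_isCompact`,
  `HarishChandraGrowthGL`).

Main statement: `AutomorphyDatum.isRegular_gl hcpt : (AutomorphyDatum.gl n K hcpt).IsRegular`.
With it every theorem of the general theory stated for a regular datum (`AutomorphicFormsStable`,
`ArchimedeanEnvelopingActionRegular`, `AutomorphicFormsStableHolds`, …) applies to `GL_n` verbatim.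
No definitions, no named facts.

## References

* A. Borel, H. Jacquet, *Automorphic forms and automorphic representations*, Proc. Sympos. Pure
  Math. 33.1 (1979), §1.1–1.2 and §4.1–4.2 [BorelJacquetCorvallis1979].
* A. W. Knapp, *Lie Groups Beyond an Introduction*, 2nd ed. (2002), I.§1 and VI.§2 [Knapp2002].
-/

noncomputable section

open scoped MatrixGroups Classical
open NumberField NumberField.mixedEmbedding IsDedekindDomain

namespace Literature.NumberTheory.Automorphic

variable {n : ℕ} {K : Type} [Field K] [NumberField K]

/-- **Levels of `GL_n` are open in `G(𝔸_f)`**: for `U = {1} × U₀` with `U₀ ≤ GL_n(𝔸_K^∞)` open,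
`U ∩ G(𝔸_f)` is open in `G(𝔸_f) = range GLn.ofFinite ≤ GL_n(𝔸_K)` — it is the preimage of `U₀`
under the continuous retraction `GLn.sndHom`. Borel–Jacquet 1979, §4.1. [cite: BorelJacquetCorvallis1979, §4.1] -/
theorem isOpen_comap_rangeOfFinite_of_mem_finiteLevelsGL
    {U : Subgroup (GL (Fin n) (AdeleRing (𝓞 K) K))} (hU : U ∈ finiteLevelsGL n K) :
    IsOpen ((U.comap (GLn.ofFinite n K).range.subtype : Subgroup (GLn.ofFinite n K).range) :
      Set (GLn.ofFinite n K).range) := by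
  obtain ⟨U₀, hU₀, -, rfl⟩ := hU
  have key : ((Subgroup.comap (GLn.ofFinite n K).range.subtype (U₀.map (GLn.ofFinite n K)) :
      Subgroup (GLn.ofFinite n K).range) : Set (GLn.ofFinite n K).range) =
      (fun x : (GLn.ofFinite n K).range =>
        GLn.sndHom n K (x : GL (Fin n) (AdeleRing (𝓞 K) K))) ⁻¹'
          (U₀ : Set (GL (Fin n) (FiniteAdeleRing (𝓞 K) K))) := by
    ext x
    obtain ⟨_, h, rfl⟩ := x
    constructor
    · rintro ⟨u, hu, e⟩
      change GLn.ofFinite n K u = GLn.ofFinite n K h at e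
      change GLn.sndHom n K (GLn.ofFinite n K h) ∈ U₀
      have hu' : u = h := by simpa using congrArg (GLn.sndHom n K) e
      rw [GLn.sndHom_ofFinite]
      exact hu' ▸ hu
    · intro hh
      change GLn.sndHom n K (GLn.ofFinite n K h) ∈ U₀ at hh
      rw [GLn.sndHom_ofFinite] at hh
      exact ⟨h, hh, rfl⟩
  rw [key]
  exact hU₀.preimage (GLn.continuous_sndHom.comp continuous_subtype_val)

/-- **Every open subgroup of `G(𝔸_f)` contains a level** (`GL_n`): if `V ∩ G(𝔸_f)` is open in
`G(𝔸_f) = range GLn.ofFinite`, then `U₀ := GLn.ofFinite⁻¹(V) ∩ GL_n(𝒪̂_K)` is a compact open subgroup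
of `GL_n(𝔸_K^∞)` (`GL_n(𝒪̂_K)` is open, `isOpen_glFiniteIntegralLevel`, and compact, `hcpt`; an open
subgroup is closed) and `{1} × U₀ ≤ V` is a level. Borel–Jacquet 1979, §4.1 (compact open subgroups
of `G(𝔸_f)` form a neighbourhood basis of `1`). [cite: BorelJacquetCorvallis1979, §4.1] -/
theorem exists_mem_finiteLevelsGL_le (hcpt : isCompact_glFiniteIntegralLevel n K)
    (V : Subgroup (GL (Fin n) (AdeleRing (𝓞 K) K)))
    (hV : IsOpen ((V.comap (GLn.ofFinite n K).range.subtype : Subgroup (GLn.ofFinite n K).range) :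
      Set (GLn.ofFinite n K).range)) :
    ∃ U ∈ finiteLevelsGL n K, U ≤ V := by
  set r : GL (Fin n) (FiniteAdeleRing (𝓞 K) K) → (GLn.ofFinite n K).range :=
    fun h => ⟨GLn.ofFinite n K h, h, rfl⟩ with hr_def
  have hr : Continuous r := (GLn.continuous_ofFinite n K).subtype_mk _
  have h1 : IsOpen ((V.comap (GLn.ofFinite n K) : Subgroup (GL (Fin n) (FiniteAdeleRing (𝓞 K) K))) :
      Set (GL (Fin n) (FiniteAdeleRing (𝓞 K) K))) := hV.preimage hr
  set U₀ : Subgroup (GL (Fin n) (FiniteAdeleRing (𝓞 K) K)) :=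
    V.comap (GLn.ofFinite n K) ⊓ glFiniteIntegralLevel n K with hU₀_def
  have hopen : IsOpen (U₀ : Set (GL (Fin n) (FiniteAdeleRing (𝓞 K) K))) := by
    rw [hU₀_def, Subgroup.coe_inf]
    exact h1.inter (isOpen_glFiniteIntegralLevel n K)
  have hcompact : IsCompact (U₀ : Set (GL (Fin n) (FiniteAdeleRing (𝓞 K) K))) :=
    IsCompact.of_isClosed_subset hcpt (U₀.isClosed_of_isOpen hopen) fun _ hx => hx.2
  refine ⟨U₀.map (GLn.ofFinite n K), ⟨U₀, hopen, hcompact, rfl⟩, ?_⟩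
  rintro _ ⟨h, hh, rfl⟩
  exact hh.1

/-- **The automorphy datum of `GL_n` over a number field is regular** (all hypotheses of
`AutomorphyDatum.IsRegular`, i.e. what Borel–Jacquet's proofs of 4.3–4.6 use, hold for
`AutomorphyDatum.gl n K hcpt`): `𝔤 = M_n(K_∞)` is full; `K_∞ ⊗ ℝ = ℝ^{r₁} × ℂ^{r₂}` is star-formally
real; `GL_n(K_∞) = K_∞ exp 𝔭` (polar decomposition); levels are open in `G(𝔸_f)` and cofinal among
its open subgroups; `1 ⊔ ‖g h‖ ≤ (1 ⊔ n ‖h‖) (1 ⊔ ‖g‖)` for all `h`, uniformly for `h = (x, 1)` with `x`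
in a compact subset of `GL_n(K_∞)` (the height is continuous there). Borel–Jacquet 1979, §1.1–1.2,
§4.1–4.2; Knapp 2002, Thm. 6.31 (c). [cite: BorelJacquetCorvallis1979, §1.2 and §4.1–4.2] -/
theorem AutomorphyDatum.isRegular_gl (hcpt : isCompact_glFiniteIntegralLevel n K) :
    (AutomorphyDatum.gl n K hcpt).IsRegular := by
  refine ⟨fun X _ => ?_, isStarFormallyReal_mixedSpace K, ?_,
    fun U hU => isOpen_comap_rangeOfFinite_of_mem_finiteLevelsGL hU,
    fun V hV => exists_mem_finiteLevelsGL_le hcpt V hV,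
    fun h _ => ⟨1 ⊔ n * adelicHeightGL n K h, fun g => one_sup_adelicHeightGL_mul_le g h⟩,
    fun s hs => ?_⟩
  · -- `𝔤 = M_n(K_∞)` is everything
    rw [AutomorphyDatum.gl_arch, archGroupGL_lie]
    trivial
  · -- the global Cartan decomposition of `GL_n(K_∞)`
    rw [AutomorphyDatum.gl_arch]
    exact hasCartanDecomposition_archGroupGL n K
  · -- local uniformity of the height inequality on `G_∞`
    obtain ⟨B, -, hB⟩ := exists_adelicHeightGL_ofInfinite_le_of_isCompact (n := n) (K := K)
      (hs.image continuous_subtype_val)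
    refine ⟨1 ⊔ n * B, fun x hx g => ?_⟩
    have hxB : adelicHeightGL n K ((AutomorphyDatum.gl n K hcpt).ofArch x) ≤ B := hB x.1 ⟨x, hx, rfl⟩
    calc 1 ⊔ (AutomorphyDatum.gl n K hcpt).height (g * (AutomorphyDatum.gl n K hcpt).ofArch x)
        ≤ (1 ⊔ n * adelicHeightGL n K ((AutomorphyDatum.gl n K hcpt).ofArch x)) *
            (1 ⊔ adelicHeightGL n K g) :=
          one_sup_adelicHeightGL_mul_le g _
      _ ≤ (1 ⊔ n * B) * (1 ⊔ adelicHeightGL n K g) := by gcongr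

end Literature.NumberTheory.Automorphic
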